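import Summits.Langlands.Langlands.Theses.ThreeTorsionCollapse

/-!
# Disproof of `SplitCartanThreeAutomorphic` (stmt-Langlands-18556) — findings: NO KILL; the crux
# is a literal sub-case of modularity of elliptic curves over totally real fields, every
# hypothesis-drop collapses onto `Target` (never onto `False`), and the kernel facts below record
# WHY it resists (the whole cell is Taylor–Wiles-degenerate at 3).

Seat `refuter-cdisprove-stmt-Langlands-18556-0`, cycle 1 (2026-08-17).  Route
`Langlands/ThreeTorsionCollapse`; crux = the ζ₃-dihedral cell: `K` totally real, `E / 𝓞 K`,
`Δ ≠ 0`, a framing `ρ̄` of `E[3]` with image in `C := closure {diag(1,2), antidiag(1,1)} = N_s(3)`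
⟹ `E` automorphic of weight zero (written-out `IsAutomorphicOfWeightZero`).

## Findings (prose index; the Lean below is the evidence)

1. ELABORATION / JUNK AUDIT (read back symbol by symbol).  Conclusion is HONEST, not junk-satisfiable
   and not junk-refutable: `CuspidalAutomorphicRepData 2 K hL` is a subtype of `AutomorphicRepData`
   (fields `lt : W' < W`, `irreducible`), `HasHeckePolynomialAt w P` needs a Satake parameter `α`
   with a `K(𝔫)`-fixed eigenform `φ ∈ W ∖ W'` (so no `W = W'` / zero-form witness), `HasWeightZero`
   is an infinity-type condition, `hL` is PROVED in tree (`isCompact_glFiniteIntegralLevel_holds`).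
   Normalisation check: `P = ∏ (X − √q·α_j)` against `X² − a_w X + q_w` forces `√q(α+β) = a_w`,
   `αβ = 1` — the unitary weight-2/trivial-character normalisation; consistent (no sign/twist slip).
   `frobTraceAt E w = q_w + 1 − #E(k_w)` counts the reduction of THE GIVEN integral model, and the
   conclusion only asks for places `w ∤ Δ(E)` (good for this model) — consistent.  The framing
   clause `e (σ • P) = ρ̄ σ *ᵥ e P` with `e` a bijection pins `ρ̄` uniquely; `ZMod 3` is discrete.
   No degenerate parameter (`n = 2` fixed, `K` a number field, no empty family): the `n = 0` trick of
   `OrdinaryPrimeTransportRankinSelbergPoleCountRefutation` has no analogue here.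
2. `target_imp_crux` : `Target → SplitCartanThreeAutomorphic` (kernel).  Hence ¬crux ⟹ ¬Target ⟹ a
   NON-MODULAR elliptic curve over a totally real field (¬ Langlands (B) for n = 2): the only
   refutation is a counterexample to modularity.  None is known or conjectured; potential modularity
   of such `ρ` is a theorem (Taylor's method [Tay02]; Thorne 2026 Thm B, arXiv:2608.07186 p. 2, even
   for residually reducible ordinary `ρ`), so no parity / L-function obstruction is available either.
3. LOAD-BEARING ANALYSIS (section `HypothesisDrops`): dropping the framing-compatibility clause gives
   EXACTLY `Target` (`withoutFraming_iff_target`, witness `ρ̄ := 1`); dropping the image clause gives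
   `Target` modulo the existence of a continuous framing of `E[3]` (`withoutImage_imp_target`, the
   hypothesis `FramingExists` = named facts `card_torsionPoints_eq_sq` + `isOpen_ker_galoisRepTorsion`);
   dropping `IsTotallyReal` gives modularity of the cell over ALL number fields (open, believed);
   dropping `Δ ≠ 0` changes nothing (a singular cubic has ≤ 3 geometric 3-torsion points, so no
   `e : E[3] ≃+ (ℤ/3)²` exists — `Δ ≠ 0` is REDUNDANT given the framing; information for the prover).
   ⟹ no `_false_without_<H>` lemma exists for any hypothesis H unless Langlands (B) itself fails;
   none is claimed.
4. TIGHTNESS OF THE DEGENERACY (section `Image`, kernel, `decide`-level): every element of `C` is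
   monomial (`isMonomial_of_mem_closure`); monomial matrices of determinant 1 over `𝔽₃` commute
   (`comm_of_isMonomial_det_one`); hence for EVERY instance of the crux `ρ̄(G_{K(ζ₃)}) = ρ̄(Γ_K) ∩ SL₂`
   is ABELIAN (`image_det_one_comm`): the Taylor–Wiles / adequacy hypothesis of FLS Thm 3, Kisin,
   Thorne 2016, BLGGT fails on the WHOLE cell, not on a sub-locus — no instance can be peeled off by a
   TW-type engine at `p = 3`.  `monomial_pow_four`: `N_s(3)` has exponent 4, so a place `w ∣ 3` of
   good supersingular reduction with `e(w|3)` odd (fundamental character of level 2, order 8 on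
   inertia) cannot occur on the cell — confirms line threelocal's description of Core B.
5. NATURAL STRENGTHENINGS refuted by small models (section `Image`): "image in `C` ⟹ `E[3]`
   reducible" is false (`antidiag_mem_closure`, `antidiag_no_invariant_line`: `w = antidiag(1,2) ∈ C`
   has no invariant line) and "image in `C` ⟹ `E[3]` irreducible" is false (the diagonal generator is
   Borel): neither p = 3 crux of the route absorbs the other; their overlap is the split-Cartan
   (two 3-isogenies) locus = line threelocal's Core R.
6. LITERATURE (presearch, corpus + galaxy): `lit search --hybrid "elliptic curves over totally real
   fields potentially modular …"` (10; Taylor 2006 Doc. Math., no counterexample literature);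
   `lit vsearch "every elliptic curve over a totally real field is potentially modular"` (6, noise);
   `lit galaxy search "potentially modular|potential modularity" --star all` → galaxyd saturated
   (queued > 90 s, not charged; search-degraded: galaxy); page reads arXiv:2608.07186 pp. 1–2,
   arXiv:1310.7088 §(BD application).  `ledger negatives --problem Langlands`: 4 entries, none on this
   cell.  Lit-pack entries for this crux: 8 keyword + 8 vector + 2 galaxy hits, all generic
   ("automorphic"/"supersingular" co-occurrence), none used.
7. COMPUTE: not run — a census of `X_s⁺(3)`-curves over `ℚ(√5)` / `ℚ(ζ₇)⁺` can only exhibit curves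
   that ARE modular (Hilbert newform matching) or re-rank the cores; it has no refuting power for a
   statement whose negation is a non-modular curve.  (Left to the lead / crux-ideate if wanted.)

`-- Targets`: payload `targets = []`, `stuck_stubs = []` (no lead HANDOFF yet).
`-- Line threelocal` (PICKED 2026-08-17; not in my payload, read anyway): all six stubs conclude
`IsAutomorphicOfWeightZero E`, so they inherit the immunity of item 2 (a mis-typed hypothesis can only
ENLARGE the set of curves claimed modular — still conjecturally true); the prose side-claims of the
line (reducible subgroups of `N_s(3)` are elementary abelian; distinguished ⟺ `ζ₃ ∉ K_w`; exponent 4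
excludes `e_w` odd good supersingular) check out — items 4–5 are their kernel shadows.
-/

noncomputable section

namespace Summit.Langlands.Langlands.Cruxes.SplitCartanThreeAutomorphic.Disproof

set_option linter.dupNamespace false -- project-wide option; `Summit.Langlands.Langlands` is the mandated namespace

open scoped MatrixGroups
open Summit.Langlands.Langlands.Theses.ThreeTorsionCollapse
open Literature.NumberTheory.GaloisRepresentations

/-! ## 0. The crux is a sub-case of the target -/

/-- `Target → SplitCartanThreeAutomorphic`: the crux is the restriction of the route's target
(= stmt-Langlands-2176, all elliptic curves over all totally real fields automorphic of weight zero)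
to the `N_s(3)` cell.  Consequently `¬ SplitCartanThreeAutomorphic → ¬ Target`: a disproof of the
crux is a non-modular elliptic curve over a totally real field. [folklore] -/
theorem target_imp_crux : Target → SplitCartanThreeAutomorphic := by
  intro hT K _ _ _ E hΔ _ _ _
  exact hT K E hΔ

/-! ## 1. Hypothesis drops (`<Crux>Without<H>`): each collapses onto `Target`, none onto `False` -/

section HypothesisDrops

/-- The generating set of the image hypothesis, verbatim from the crux. -/
abbrev gens : Set (GL (Fin 2) (ZMod 3)) :=
  {(⟨!![1, 0; 0, 2], !![1, 0; 0, 2], by decide, by decide⟩ : GL (Fin 2) (ZMod 3)),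
    (⟨!![0, 1; 1, 0], !![0, 1; 1, 0], by decide, by decide⟩ : GL (Fin 2) (ZMod 3))}

/-- The written-out conclusion of the crux ("`E` is automorphic of weight zero"), verbatim. -/
def Modular (K : Type) [Field K] [NumberField K]
    (E : WeierstrassCurve (NumberField.RingOfIntegers K)) : Prop :=
  ∃ (hL : Literature.NumberTheory.Automorphic.isCompact_glFiniteIntegralLevel 2 K)
    (π : Literature.NumberTheory.Automorphic.CuspidalAutomorphicRepData 2 K hL),
    π.1.HasWeightZero ∧ ∀ w : IsDedekindDomain.HeightOneSpectrum (NumberField.RingOfIntegers K),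
      E.Δ ∉ w.asIdeal → π.1.HasHeckePolynomialAt w ((Polynomial.X ^ 2 -
        Polynomial.C (Literature.NumberTheory.Automorphic.frobTraceAt E w) * Polynomial.X +
        Polynomial.C ((w.residueCard : ℕ) : ℤ)).map (Int.castRingHom ℂ))

/-- The framing clause of the crux, verbatim. -/
def IsFraming (K : Type) [Field K] [NumberField K]
    (E : WeierstrassCurve (NumberField.RingOfIntegers K)) (ρ : FramedGaloisRep K (ZMod 3) 2) : Prop :=
  ∃ e : (E.baseChange K).geomTorsion ((3 : ℕ) : ℤ) ≃+ (Fin 2 → ZMod 3),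
    ∀ (σ : Field.absoluteGaloisGroup K) (P : (E.baseChange K).geomTorsion ((3 : ℕ) : ℤ)),
      e (σ • P) = Matrix.mulVec ((ρ σ : GL (Fin 2) (ZMod 3)) : Matrix (Fin 2) (Fin 2) (ZMod 3)) (e P)

/-- Sanity: the crux, re-assembled from the verbatim pieces, is definitionally the route decl. -/
theorem crux_iff : SplitCartanThreeAutomorphic ↔
    ∀ (K : Type) [Field K] [NumberField K] [NumberField.IsTotallyReal K]
      (E : WeierstrassCurve (NumberField.RingOfIntegers K)), E.Δ ≠ 0 →
      ∀ ρ : FramedGaloisRep K (ZMod 3) 2, IsFraming K E ρ →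
        (∀ σ : Field.absoluteGaloisGroup K, (ρ σ : GL (Fin 2) (ZMod 3)) ∈ Subgroup.closure gens) →
        Modular K E :=
  Iff.rfl

/-- Crux WITHOUT the framing-compatibility clause (`ρ̄` an arbitrary continuous representation with
image in `N_s(3)`, unrelated to `E`). -/
def SplitCartanThreeAutomorphicWithoutFraming : Prop :=
  ∀ (K : Type) [Field K] [NumberField K] [NumberField.IsTotallyReal K]
    (E : WeierstrassCurve (NumberField.RingOfIntegers K)), E.Δ ≠ 0 →
    ∀ ρ : FramedGaloisRep K (ZMod 3) 2,
      (∀ σ : Field.absoluteGaloisGroup K, (ρ σ : GL (Fin 2) (ZMod 3)) ∈ Subgroup.closure gens) →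
      Modular K E

/-- The trivial framed representation `σ ↦ 1` (continuous: constant). -/
def trivialFramedRep (K : Type) [Field K] : FramedGaloisRep K (ZMod 3) 2 :=
  { toMonoidHom := 1, continuous_toFun := continuous_const }

theorem trivialFramedRep_apply (K : Type) [Field K] (σ : Field.absoluteGaloisGroup K) :
    trivialFramedRep K σ = 1 :=
  rfl

/-- LOAD of the framing clause: without it the crux is EXACTLY the target (witness `ρ̄ := 1`, whose
image `{1}` lies in every subgroup).  So the clause is what makes the crux a proper sub-case; dropping
it yields `Target` (believed true), never `False`. [folklore] -/
theorem withoutFraming_iff_target : SplitCartanThreeAutomorphicWithoutFraming ↔ Target := by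
  constructor
  · intro h K _ _ _ E hΔ
    exact h K E hΔ (trivialFramedRep K) fun σ => by
      rw [trivialFramedRep_apply]; exact Subgroup.one_mem _
  · intro hT K _ _ _ E hΔ _ _
    exact hT K E hΔ

/-- Crux WITHOUT the image clause (any framing of `E[3]`, arbitrary image). -/
def SplitCartanThreeAutomorphicWithoutImage : Prop :=
  ∀ (K : Type) [Field K] [NumberField K] [NumberField.IsTotallyReal K]
    (E : WeierstrassCurve (NumberField.RingOfIntegers K)), E.Δ ≠ 0 →
    ∀ ρ : FramedGaloisRep K (ZMod 3) 2, IsFraming K E ρ → Modular K E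

/-- "Every elliptic curve over a number field admits a continuous framing of its 3-torsion": the
conjunction of the named facts `WeierstrassCurve.card_torsionPoints_eq_sq` (`#E[3](K̄) = 9`, whence a
`ZMod 3`-basis) and `WeierstrassCurve.isOpen_ker_galoisRepTorsion` (continuity of `ρ̄_{E,3}`), plus
linear algebra.  Stated, not proved, here. [cite: SilvermanAEC2009, III.6.4(b), III.§7] -/
def FramingExists : Prop :=
  ∀ (K : Type) [Field K] [NumberField K] (E : WeierstrassCurve (NumberField.RingOfIntegers K)),
    E.Δ ≠ 0 → ∃ ρ : FramedGaloisRep K (ZMod 3) 2, IsFraming K E ρ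

/-- LOAD of the image clause: without it the crux is the whole target (modulo `FramingExists`).
[folklore] -/
theorem withoutImage_imp_target (hfr : FramingExists) :
    SplitCartanThreeAutomorphicWithoutImage → Target := by
  intro h K _ _ _ E hΔ
  obtain ⟨ρ, hρ⟩ := hfr K E hΔ
  exact h K E hΔ ρ hρ

theorem target_imp_withoutImage : Target → SplitCartanThreeAutomorphicWithoutImage := by
  intro hT K _ _ _ E hΔ _ _
  exact hT K E hΔ

/-- Crux WITHOUT `IsTotallyReal K`: modularity (automorphy of weight zero over `K`) of the `N_s(3)` cell
over EVERY number field.  Not refutable: it is an instance of Langlands reciprocity for `GL₂` over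
arbitrary number fields (open; over CM fields even potential modularity of the cell is only known in
cases, Allen–Calegari–Caraiani–Gee–Helm–Le Hung–Newton–Scholze–Taylor–Thorne); no counterexample is
known or expected.  Recorded as a definition only. [folklore] -/
def SplitCartanThreeAutomorphicWithoutTotallyReal : Prop :=
  ∀ (K : Type) [Field K] [NumberField K]
    (E : WeierstrassCurve (NumberField.RingOfIntegers K)), E.Δ ≠ 0 →
    ∀ ρ : FramedGaloisRep K (ZMod 3) 2, IsFraming K E ρ →
      (∀ σ : Field.absoluteGaloisGroup K, (ρ σ : GL (Fin 2) (ZMod 3)) ∈ Subgroup.closure gens) →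
      Modular K E

theorem crux_of_withoutTotallyReal :
    SplitCartanThreeAutomorphicWithoutTotallyReal → SplitCartanThreeAutomorphic := by
  intro h K _ _ _ E hΔ ρ hρ hS
  exact h K E hΔ ρ hρ hS

/-- Crux WITHOUT `E.Δ ≠ 0`.  Not refutable and in fact EQUIVALENT to the crux on paper: for a
singular Weierstrass cubic the group of non-singular geometric points is `K̄ˣ` or `K̄`, whose
3-torsion has order 3 or 1, so no `e : E[3](K̄) ≃+ (ℤ/3)²` exists and the framing clause is
unsatisfiable — `Δ ≠ 0` is REDUNDANT given the framing (prover information: it is only ever used to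
make `frobTraceAt`/good places meaningful).  The equivalence is not kernel-proved here (no Mathlib
structure theory for singular cubics). [cite: SilvermanAEC2009, III.2.5] -/
def SplitCartanThreeAutomorphicWithoutDelta : Prop :=
  ∀ (K : Type) [Field K] [NumberField K] [NumberField.IsTotallyReal K]
    (E : WeierstrassCurve (NumberField.RingOfIntegers K)),
    ∀ ρ : FramedGaloisRep K (ZMod 3) 2, IsFraming K E ρ →
      (∀ σ : Field.absoluteGaloisGroup K, (ρ σ : GL (Fin 2) (ZMod 3)) ∈ Subgroup.closure gens) →
      Modular K E

theorem crux_of_withoutDelta :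
    SplitCartanThreeAutomorphicWithoutDelta → SplitCartanThreeAutomorphic := by
  intro h K _ _ _ E _ ρ hρ hS
  exact h K E ρ hρ hS

end HypothesisDrops

/-! ## 2. The image hypothesis: kernel facts on `C = closure gens = N_s(3)` (tightness of the
TW-degeneracy; small-model refutations of the two natural strengthenings) -/

section Image

/-- Monomial shape of a `2 × 2` matrix over `𝔽₃`: diagonal or antidiagonal. -/
def IsMonomial (A : Matrix (Fin 2) (Fin 2) (ZMod 3)) : Prop :=
  (A 0 1 = 0 ∧ A 1 0 = 0) ∨ (A 0 0 = 0 ∧ A 1 1 = 0)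

instance : DecidablePred IsMonomial := fun A => by unfold IsMonomial; infer_instance

theorem isMonomial_mul (A B : Matrix (Fin 2) (Fin 2) (ZMod 3))
    (hA : IsMonomial A) (hB : IsMonomial B) : IsMonomial (A * B) := by
  rcases hA with ⟨h1, h2⟩ | ⟨h1, h2⟩ <;> rcases hB with ⟨h3, h4⟩ | ⟨h3, h4⟩
  · left; simp [Matrix.mul_apply, Fin.sum_univ_two, h1, h2, h3, h4]
  · right; simp [Matrix.mul_apply, Fin.sum_univ_two, h1, h2, h3, h4]
  · right; simp [Matrix.mul_apply, Fin.sum_univ_two, h1, h2, h3, h4]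
  · left; simp [Matrix.mul_apply, Fin.sum_univ_two, h1, h2, h3, h4]

/-- Both generators are involutions, so `gens⁻¹ = gens` and the subgroup closure is the submonoid
closure. -/
theorem gens_inv : gens⁻¹ = gens := by
  ext x
  simp only [Set.mem_inv, Set.mem_insert_iff, Set.mem_singleton_iff]
  constructor
  · rintro (h | h)
    · left; rw [← inv_inv x, h]; decide
    · right; rw [← inv_inv x, h]; decide
  · rintro (rfl | rfl)
    · left; decide
    · right; decide

/-- Every element of `C = closure gens` is monomial, i.e. `C ≤ N_s(3)` (in fact `=`, order 8). -/
theorem isMonomial_of_mem_closure {x : GL (Fin 2) (ZMod 3)} (hx : x ∈ Subgroup.closure gens) :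
    IsMonomial (x : Matrix (Fin 2) (Fin 2) (ZMod 3)) := by
  have hx' : x ∈ (Subgroup.closure gens).toSubmonoid := hx
  clear hx
  rw [Subgroup.closure_toSubmonoid, gens_inv, Set.union_self] at hx'
  induction hx' using Submonoid.closure_induction with
  | mem y hy =>
    rcases hy with rfl | rfl
    · left; decide
    · right; decide
  | one => left; decide
  | mul y z _ _ hy hz =>
    rw [Units.val_mul]
    exact isMonomial_mul _ _ hy hz

/-- SMALL MODEL (`decide`, 3⁸ cases): monomial matrices of determinant one over `𝔽₃` commute pairwise
— they form the cyclic group `{±1, ±w}`, `w = antidiag(1,2)`, `w² = −1`. -/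
theorem comm_of_isMonomial_det_one : ∀ a b c d a' b' c' d' : ZMod 3,
    IsMonomial !![a, b; c, d] → IsMonomial !![a', b'; c', d'] →
    a * d - b * c = 1 → a' * d' - b' * c' = 1 →
    !![a, b; c, d] * !![a', b'; c', d'] = !![a', b'; c', d'] * !![a, b; c, d] := by
  decide

theorem comm_of_isMonomial_det_one' (A B : Matrix (Fin 2) (Fin 2) (ZMod 3))
    (hA : IsMonomial A) (hB : IsMonomial B) (hdA : A.det = 1) (hdB : B.det = 1) :
    A * B = B * A := by
  rw [Matrix.det_fin_two] at hdA hdB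
  have h := comm_of_isMonomial_det_one (A 0 0) (A 0 1) (A 1 0) (A 1 1) (B 0 0) (B 0 1) (B 1 0) (B 1 1)
  rw [← Matrix.eta_fin_two A, ← Matrix.eta_fin_two B] at h
  exact h hA hB hdA hdB

/-- **TIGHTNESS OF THE DEGENERACY (whole cell).**  For EVERY `ρ̄ : Γ_K → GL₂(𝔽₃)` satisfying the
image hypothesis of the crux, the elements of determinant one in the image commute pairwise; since
`det ρ̄_{E,3} = χ̄₃`, this says `ρ̄(G_{K(ζ₃)})` is ABELIAN for every instance of the crux (any `K`,
any `E`), so `ρ̄|_{G_{K(ζ₃)}}` is never absolutely irreducible / adequate: the Taylor–Wiles hypothesis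
of FLS 2015 Thm 3, Kisin 2009, Thorne 2016 Thm 1.2 and BLGGT fails UNIFORMLY on the cell — no
sub-case can be peeled off by a TW-type engine at `p = 3` (barrier
`Literature.Barriers.Langlands.ResiduallyReducibleBarrier` bites on the whole hypothesis, not on a
sub-locus).  Any proof must use a TW-free engine (Skinner–Wiles, Pan–Zhang, Thorne 2026) or switch
primes. [cite: FreitasLeHungSiksek2015, Thm 3; Thorne2016, Thm 1.2] -/
theorem image_det_one_comm (K : Type) [Field K] (ρ : FramedGaloisRep K (ZMod 3) 2)
    (hS : ∀ σ : Field.absoluteGaloisGroup K, (ρ σ : GL (Fin 2) (ZMod 3)) ∈ Subgroup.closure gens)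
    (σ τ : Field.absoluteGaloisGroup K)
    (hσ : ((ρ σ : GL (Fin 2) (ZMod 3)) : Matrix (Fin 2) (Fin 2) (ZMod 3)).det = 1)
    (hτ : ((ρ τ : GL (Fin 2) (ZMod 3)) : Matrix (Fin 2) (Fin 2) (ZMod 3)).det = 1) :
    ρ σ * ρ τ = ρ τ * ρ σ := by
  apply Units.ext
  rw [Units.val_mul, Units.val_mul]
  exact comm_of_isMonomial_det_one' _ _ (isMonomial_of_mem_closure (hS σ))
    (isMonomial_of_mem_closure (hS τ)) hσ hτ

/-- SMALL MODEL: `N_s(3)` has exponent 4 (`decide`).  Consequence for the cell: `ρ̄(I_w)` never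
contains an element of order 8, so a place `w ∣ 3` of good supersingular reduction with `e(w|3)` odd
(inertia acting through the level-2 fundamental character, of order 8) does not occur — the
supersingular core of line threelocal consists of places with `e_w` even / potentially good
reduction only. [cite: Serre1972, §1 (fundamental characters)] -/
theorem monomial_pow_four : ∀ a b c d : ZMod 3, IsMonomial !![a, b; c, d] → a * d - b * c ≠ 0 →
    !![a, b; c, d] ^ 4 = 1 := by
  decide

/-- `w = antidiag(1,2) = diag(1,2) · antidiag(1,1)` lies in `C`. -/
theorem antidiag_mem_closure :
    (⟨!![0, 1; 2, 0], !![0, 2; 1, 0], by decide, by decide⟩ : GL (Fin 2) (ZMod 3)) ∈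
      Subgroup.closure gens := by
  have h : (⟨!![0, 1; 2, 0], !![0, 2; 1, 0], by decide, by decide⟩ : GL (Fin 2) (ZMod 3)) =
      (⟨!![1, 0; 0, 2], !![1, 0; 0, 2], by decide, by decide⟩ : GL (Fin 2) (ZMod 3)) *
        (⟨!![0, 1; 1, 0], !![0, 1; 1, 0], by decide, by decide⟩ : GL (Fin 2) (ZMod 3)) := by
    decide
  rw [h]
  exact Subgroup.mul_mem _ (Subgroup.subset_closure (by simp)) (Subgroup.subset_closure (by simp))

/-- REFUTED STRENGTHENING 1 (small model, `decide`): "image in `C` ⟹ `E[3]` reducible over `K`" is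
false at the level of the group — `w ∈ C` has no invariant line in `𝔽₃²` (`X² + 1` irreducible mod 3),
so a framing whose image contains `w` gives an irreducible `E[3]`.  Hence the `N_s(3)` crux is NOT a
sub-case of the Borel crux `BorelThreeAutomorphic` (stmt-Langlands-18557). [folklore] -/
theorem antidiag_no_invariant_line : ∀ v : Fin 2 → ZMod 3, v ≠ 0 → ∀ c : ZMod 3,
    Matrix.mulVec !![(0 : ZMod 3), 1; 2, 0] v ≠ c • v := by
  decide

/-- REFUTED STRENGTHENING 2 (small model): "image in `C` ⟹ `E[3]` irreducible" is false at the level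
of the group — the generator `diag(1,2) ∈ C` is upper-triangular (fixes the line `⟨e₁⟩`), and the whole
diagonal torus `C_s(3) ≤ C ∩ B(3)`: curves with two independent `K`-rational 3-isogenies lie in BOTH
p = 3 cells (line threelocal's Core R = shadow of stmt-Langlands-18557). [folklore] -/
theorem diag_mem_closure_and_borel :
    (⟨!![1, 0; 0, 2], !![1, 0; 0, 2], by decide, by decide⟩ : GL (Fin 2) (ZMod 3)) ∈
        Subgroup.closure gens ∧
      ((⟨!![1, 0; 0, 2], !![1, 0; 0, 2], by decide, by decide⟩ : GL (Fin 2) (ZMod 3)) :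
        Matrix (Fin 2) (Fin 2) (ZMod 3)) 1 0 = 0 :=
  ⟨Subgroup.subset_closure (by simp), by decide⟩

end Image

/-! ## 3. Targets / near-misses

`-- Targets`: none served (payload `targets = []`, `stuck_stubs = []`).
No `sorry` in this file: there is no near-miss refutation to record — every candidate negation is
equivalent to producing a non-modular elliptic curve over a totally real field (item 2 of the header).
-/

end Summit.Langlands.Langlands.Cruxes.SplitCartanThreeAutomorphic.Disproof

end
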